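import Summits.BirchSwinnertonDyer.BirchSwinnertonDyer.Theorems.EisensteinDepletionAtTwoStarOptBSFTheoremAFormal
import Summits.BirchSwinnertonDyer.BirchSwinnertonDyer.Theorems.EisensteinDepletionAtTwoStarKummerAlgEven
import Summits.BirchSwinnertonDyer.BirchSwinnertonDyer.Theorems.EisensteinDepletionAtTwoStarEvenSquareLaw
import Summits.BirchSwinnertonDyer.BirchSwinnertonDyer.Theorems.EisensteinDepletionAtTwoStarEtaleLiftSecondPointPrelims
import Literature.NumberTheory.EllipticCurves.FormalGroupMultiplicationUniversalProofs
import Literature.NumberTheory.EllipticCurves.ManinConstantGamma1ModularDegree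
import HarnessLib

/-!
# Line `star` v19 on crux E1M (stmt-BirchSwinnertonDyer-20341): the research stub S2 `stub_evenKummerForm` REDUCED to the
# local EVEN SQUARE LAW `B∘[2] ∈ ℤ⟦T⟧` (lead star-p1 GEN 21, 2026-08-29)

The even branch of the parity split (v18, stub S2): for the `X₀(N)`-lattice-optimal curve `W₀` (Néron lattice `L₀ = q·Λ_f`) with an
EVEN Manin multiple `q`, an ÉTALE rational 2-torsion abscissa `x₀` with half-period `λ/2`, and a proper parity group `Γ′ < Γ₁(N)`,
the parity cover carries a non-zero anti-invariant cusp form with an integral multiple.  This file proves that implication from ONE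
local statement of pure formal-group algebra, the **even square law**

  (SqL) `B(T)² = X(T) − x₀T²`, `B(0) = 1` (`X = T²x(T) = formalXMulSq`) ⇒ `B([2]T) ∈ ℤ⟦T⟧`,

proved in `Theorems/EisensteinDepletionAtTwoStarEvenSquareLaw.lean` (`EvenBranch.evenSquareLaw_int`: `B([2]T)·K = M·G` with
`K, M, G ∈ ℤ⟦T⟧`, `K(0) = 1`, from the tree's cleared duplication identities `formalXMulSq_formalMul_two'`/`…twoY'`) and transported
here to the globally minimal rational model (`evenSquareLaw`: an étale 2-torsion point of a minimal model is integral).  MECHANISM (why the even multiple removes the `2`-power denominators of the étale square root):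
the integral parameter series of the parametrisation scaled by `q = 2m` is `Z_q = exp_W(q·ℓ_f) = [2](Z_m)` with `Z_m = exp_W(m·ℓ_f) ∈ ℤ⟦q⟧`
(Honda, `ParamIntegral.stub_paramIntegralFormal`), so `B(Z_q) = (B∘[2])(Z_m) ∈ ℤ⟦q⟧`; the rest is line nsf's `X₁(N)` engine verbatim
(`sqrtCuspForm_even` = `ThmAFormal.sqrtCuspForm_noOut` with the half-integrality of `B` replaced by the integrality of `B(Z_q)`, through
`KummerAlg.kummerAlg_of_substInt`).

* `exists_formalSqrt` — the square root `B` (binomial series), no parity hypothesis;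
* `formalMul_two_subst_formalExp_subst` — `[2](exp_W u) = exp_W(u + u)`;
* `sqrtCuspForm_even` — the engine with `B(z) ∈ ℤ⟦q⟧` as data;
* `evenSquareLaw` — (SqL) for the globally minimal rational model and an étale rational 2-torsion abscissa;
* `stub_evenKummerForm` — **registered stub S2 of line `star` v18, PROVED** (signature verbatim).

UNCONDITIONAL (no named-fact hypothesis); no `sorry`, no new definition; nothing here reads `r_an`; E1M / BSD are NOT proved by this file.
-/

set_option linter.dupNamespace false
set_option autoImplicit false

noncomputable section

namespace Summit.BirchSwinnertonDyer.BirchSwinnertonDyer.Theorems.DepletionAtTwo.EvenBranch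

open scoped MatrixGroups ModularForm
open CongruenceSubgroup PowerSeries
open Literature.NumberTheory.EllipticCurves
open Literature.NumberTheory.EllipticCurves.Greenberg1999
open Literature.NumberTheory.EllipticCurves.ModularForms

/-- The formal square root `B = √(X(T) − x₁T²)` with `B(0) = 1` (binomial series `(1 + g)^{1/2}`, `g = X − 1 − x₁T²`).
[cite: SilvermanAEC2009, IV.1] [folklore] -/
theorem exists_formalSqrt (W : WeierstrassCurve ℚ) (x₁ : ℚ) :
    ∃ B : PowerSeries ℚ, PowerSeries.constantCoeff B = 1 ∧
      B ^ 2 = W.formalXMulSq - PowerSeries.C x₁ * PowerSeries.X ^ 2 := by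
  set g : ℚ⟦X⟧ := W.formalXMulSq - 1 - C x₁ * X ^ 2 with hg
  have hg0 : constantCoeff g = 0 := by
    simp [hg, WeierstrassCurve.constantCoeff_formalXMulSq]
  have hgs : HasSubst g := HasSubst.of_constantCoeff_zero' hg0
  set B₀ : ℚ⟦X⟧ := (PowerSeries.binomialSeries ℚ (1 / 2 : ℚ)).subst g with hB₀
  have hB₀sq : B₀ ^ 2 = W.formalXMulSq - C x₁ * X ^ 2 := by
    rw [hB₀, ← subst_pow hgs, sq, ← binomialSeries_add,
      show (1 / 2 : ℚ) + 1 / 2 = ((1 : ℕ) : ℚ) by norm_num, binomialSeries_nat, pow_one,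
      subst_add hgs, subst_X hgs, ← coe_substAlgHom hgs, map_one, hg]
    ring
  have hc : constantCoeff B₀ = 1 ∨ constantCoeff B₀ = -1 := by
    have h1 : constantCoeff B₀ ^ 2 = 1 ^ 2 := by
      rw [← map_pow, hB₀sq, map_sub, map_mul, WeierstrassCurve.constantCoeff_formalXMulSq]
      simp
    exact eq_or_eq_neg_of_sq_eq_sq _ _ h1
  rcases hc with h | h
  · exact ⟨B₀, h, hB₀sq⟩
  · exact ⟨-B₀, by rw [map_neg, h, neg_neg], by rw [neg_sq, hB₀sq]⟩

/-- `log_W(exp_W(v)) = v` for `v ∈ Tℚ⟦T⟧`. [cite: SilvermanAEC2009, IV.5] [folklore] -/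
theorem formalLog_subst_formalExp_subst' (W : WeierstrassCurve ℚ) {v : PowerSeries ℚ}
    (hv : PowerSeries.constantCoeff v = 0) : W.formalLog.subst (W.formalExp.subst v) = v := by
  have hsv : HasSubst v := HasSubst.of_constantCoeff_zero' hv
  have e := subst_comp_subst_apply (HasSubst.of_constantCoeff_zero' W.constantCoeff_formalExp) hsv W.formalLog
  rw [W.formalLog_subst_formalExp, subst_X hsv] at e
  exact e.symm

/-- **`[2](exp_W(u)) = exp_W(u + u)`** (`u ∈ Tℚ⟦T⟧`): both sides have formal logarithm `2u`. [cite: SilvermanAEC2009, IV.2.3, IV.5.2] -/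
theorem formalMul_two_subst_formalExp_subst (W : WeierstrassCurve ℚ) {u : PowerSeries ℚ}
    (hu : PowerSeries.constantCoeff u = 0) :
    (W.formalMul 2).subst (W.formalExp.subst u) = W.formalExp.subst (u + u) := by
  have huu : constantCoeff (u + u) = 0 := by rw [map_add, hu, add_zero]
  have hE0 : constantCoeff (W.formalExp.subst u) = 0 :=
    constantCoeff_subst_eq_zero hu _ W.constantCoeff_formalExp
  have hEE0 : constantCoeff (W.formalExp.subst (u + u)) = 0 :=
    constantCoeff_subst_eq_zero huu _ W.constantCoeff_formalExp
  have hsE : HasSubst (W.formalExp.subst u) := HasSubst.of_constantCoeff_zero' hE0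
  have hD0 : constantCoeff ((W.formalMul 2).subst (W.formalExp.subst u)) = 0 :=
    constantCoeff_subst_eq_zero hE0 _ (W.constantCoeff_formalMul 2)
  refine W.eq_of_formalLog_subst_eq hD0 hEE0 ?_
  rw [← subst_comp_subst_apply (W.hasSubst_formalMul 2) hsE, W.formalLog_subst_formalMul_rat,
    ← coe_substAlgHom hsE, map_nsmul, coe_substAlgHom, formalLog_subst_formalExp_subst' W hu,
    formalLog_subst_formalExp_subst' W huu, two_nsmul]

/-- **The even square law for a globally minimal rational model**: for an ÉTALE rational 2-torsion abscissa `x₀` (so `x₀ ∈ ℤ`, and the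
ordinate is an integer too) and `B = √(X(T) − x₀T²)`, `B(0) = 1`: `B([2]T) ∈ ℤ⟦T⟧` (`EvenBranch.evenSquareLaw_int` on the integral model).
[cite: SilvermanAEC2009, III.2.3(d), IV.2, VII.3.4] -/
theorem evenSquareLaw (W₀ : WeierstrassCurve ℚ) [W₀.IsElliptic] [W₀.IsGloballyMinimal] {x₀ : ℚ}
    (hx₀ : HasRationalTwoTorsionX W₀ x₀) (hnr : ¬ TwoTorsionRamifiedAtTwo x₀)
    (B : PowerSeries ℚ) (hB0 : PowerSeries.constantCoeff B = 1)
    (hBsq : B ^ 2 = W₀.formalXMulSq - PowerSeries.C x₀ * PowerSeries.X ^ 2) :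
    ∃ R : PowerSeries ℤ, PowerSeries.map (Int.castRingHom ℚ) R = B.subst (W₀.formalMul 2) := by
  obtain ⟨ξ, hξ⟩ :=
    Summit.BirchSwinnertonDyer.BirchSwinnertonDyer.Theorems.DepletionAtTwo.SigmaNode.exists_int_eq_of_etale W₀ hx₀ hnr
  obtain ⟨y, hEq, h2⟩ := hx₀
  rw [WeierstrassCurve.Affine.equation_iff] at hEq
  set V : WeierstrassCurve ℤ := WeierstrassCurve.integralModelInt W₀ with hV
  have hVW : V.map (Int.castRingHom ℚ) = W₀ := WeierstrassCurve.map_integralModelInt W₀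
  have ha₁ : W₀.a₁ = (V.a₁ : ℚ) := by rw [← hVW, WeierstrassCurve.map_a₁, eq_intCast]
  have ha₂ : W₀.a₂ = (V.a₂ : ℚ) := by rw [← hVW, WeierstrassCurve.map_a₂, eq_intCast]
  have ha₃ : W₀.a₃ = (V.a₃ : ℚ) := by rw [← hVW, WeierstrassCurve.map_a₃, eq_intCast]
  have ha₄ : W₀.a₄ = (V.a₄ : ℚ) := by rw [← hVW, WeierstrassCurve.map_a₄, eq_intCast]
  have ha₆ : W₀.a₆ = (V.a₆ : ℚ) := by rw [← hVW, WeierstrassCurve.map_a₆, eq_intCast]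
  have hT2Q : 2 * y + (V.a₁ : ℚ) * (ξ : ℚ) + (V.a₃ : ℚ) = 0 := by
    rw [← ha₁, ← ha₃, hξ]; linear_combination h2
  have hT1Q : y ^ 2 + (V.a₁ : ℚ) * ξ * y + (V.a₃ : ℚ) * y =
      (ξ : ℚ) ^ 3 + (V.a₂ : ℚ) * ξ ^ 2 + (V.a₄ : ℚ) * ξ + V.a₆ := by
    rw [← ha₁, ← ha₂, ← ha₃, ← ha₄, ← ha₆, hξ]; linear_combination hEq
  -- the ordinate is an integer: `2y = k ∈ ℤ`, `y² ∈ ℤ`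
  set k : ℤ := -(V.a₁ * ξ + V.a₃) with hk
  have hky : (k : ℚ) = 2 * y := by rw [hk]; push_cast; linear_combination -hT2Q
  have hy2 : y ^ 2 = -((ξ : ℚ) ^ 3 + (V.a₂ : ℚ) * ξ ^ 2 + (V.a₄ : ℚ) * ξ + V.a₆) := by
    linear_combination -hT1Q + y * hT2Q
  have hk2 : k ^ 2 = 2 * (2 * (-(ξ ^ 3 + V.a₂ * ξ ^ 2 + V.a₄ * ξ + V.a₆))) := by
    have h : ((k ^ 2 : ℤ) : ℚ) = ((2 * (2 * (-(ξ ^ 3 + V.a₂ * ξ ^ 2 + V.a₄ * ξ + V.a₆))) : ℤ) : ℚ) := by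
      push_cast; rw [hky]; linear_combination 4 * hy2
    exact_mod_cast h
  have hkev : Even k :=
    (Int.even_pow.mp ⟨2 * (-(ξ ^ 3 + V.a₂ * ξ ^ 2 + V.a₄ * ξ + V.a₆)), by rw [hk2]; ring⟩).1
  obtain ⟨yI, hyI⟩ := hkev
  have hyyI : y = (yI : ℚ) := by
    have h := hky
    rw [hyI] at h; push_cast at h; linarith
  have hT2 : 2 * yI + V.a₁ * ξ + V.a₃ = 0 := by
    have h : ((2 * yI + V.a₁ * ξ + V.a₃ : ℤ) : ℚ) = 0 := by push_cast; rw [← hyyI]; exact hT2Q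
    exact_mod_cast h
  have hT1 : yI ^ 2 + V.a₁ * ξ * yI + V.a₃ * yI = ξ ^ 3 + V.a₂ * ξ ^ 2 + V.a₄ * ξ + V.a₆ := by
    have h : ((yI ^ 2 + V.a₁ * ξ * yI + V.a₃ * yI : ℤ) : ℚ) = ((ξ ^ 3 + V.a₂ * ξ ^ 2 + V.a₄ * ξ + V.a₆ : ℤ) : ℚ) := by
      push_cast; rw [← hyyI]; exact hT1Q
    exact_mod_cast h
  -- the integral law on the integral model
  have hBsq' : B ^ 2 = (V.map (Int.castRingHom ℚ)).formalXMulSq - PowerSeries.C (ξ : ℚ) * PowerSeries.X ^ 2 := by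
    rw [hVW, hξ]; exact hBsq
  obtain ⟨R, hR⟩ := evenSquareLaw_int V ξ yI hT1 hT2 B hB0 hBsq'
  exact ⟨R, by rw [hR, hVW]⟩

/-- `ThmAFormal.sqrtCuspForm_noOut` with the half-integrality `2B ∈ ℤ⟦T⟧` of the square root replaced by the INTEGRALITY OF THE
SUBSTITUTED SERIES `B(z) ∈ ℤ⟦q⟧` (given as `Bint`): the anti-invariant cusp form of a rational 2-torsion point with given half-period,
on a parity subgroup `Γ′ ≤ Γ₁(N)`, with an integral multiple.  Same proof, `KummerAlg.kummerAlg_of_substInt` replacing `stub_kummerAlg`.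
[cite: ShimuraIATAF1971, §2.4 and Thm. 7.14] [cite: SilvermanAEC2009, VI.3.6] -/
theorem sqrtCuspForm_even :
    ∀ (W₁ : WeierstrassCurve ℚ) [W₁.IsElliptic] [W₁.IsGloballyMinimal]
      ⦃N : ℕ⦄ [NeZero N] (f : CuspForm (CongruenceSubgroup.Gamma0 N) 2), IsNewformOf W₁ f →
      ∀ (L₁ : PeriodPair), IsNeronLatticeOf (W₁.baseChange ℂ) L₁ →
      ∀ (c₁ : ℚ), c₁ ≠ 0 → (∀ z ∈ periodLatticeGamma1 f, (c₁ : ℂ) * z ∈ L₁.lattice) →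
      ∀ (x₁ : ℚ), HasRationalTwoTorsionX W₁ x₁ →
      ∀ (lam : ℂ), lam ∈ L₁.lattice → lam / 2 ∉ L₁.lattice →
        L₁.weierstrassP (lam / 2) - ((W₁.b₂ : ℚ) : ℂ) / 12 = ((x₁ : ℚ) : ℂ) →
        ∀ (Γ' : Subgroup SL(2, ℤ)),
          (∀ γ : SL(2, ℤ), γ ∈ Γ' ↔ ∃ hγ : γ ∈ CongruenceSubgroup.Gamma0 N, γ ∈ CongruenceSubgroup.Gamma1 N ∧
            ∃ k : ℤ, ∃ w ∈ L₁.lattice, (c₁ : ℂ) * cuspSymbol f ⟨γ, hγ⟩ = (k : ℂ) * lam + 2 * w) →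
          -- (S1') the formal square root (no integrality)
          ∀ (B : PowerSeries ℚ), PowerSeries.constantCoeff B = 1 →
            B ^ 2 = W₁.formalXMulSq - PowerSeries.C x₁ * PowerSeries.X ^ 2 →
          -- (S2) the integral expansion of the formal parameter along the parametrisation
          ∀ (zq : PowerSeries ℤ), PowerSeries.constantCoeff zq = 0 → PowerSeries.coeff 1 zq ≠ 0 →
            (∃ A : ℝ, ∀ τ : UpperHalfPlane, A < τ.im →
          HasSum (fun n : ℕ ↦ ((PowerSeries.coeff n zq : ℤ) : ℂ) *
              Complex.exp (2 * Real.pi * Complex.I * (τ : ℂ)) ^ n)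
            (-(L₁.weierstrassP ((c₁ : ℂ) * eichlerIntegral f τ) - ((W₁.b₂ : ℚ) : ℂ) / 12) /
              ((L₁.derivWeierstrassP ((c₁ : ℂ) * eichlerIntegral f τ)
                - ((W₁.a₁ : ℚ) : ℂ) * (L₁.weierstrassP ((c₁ : ℂ) * eichlerIntegral f τ) - ((W₁.b₂ : ℚ) : ℂ) / 12)
                - ((W₁.a₃ : ℚ) : ℂ)) / 2))) →
          -- (SqL-subst) the substituted square root is integral
          ∀ (Bint : PowerSeries ℤ),
            PowerSeries.map (Int.castRingHom ℚ) Bint = B.subst (PowerSeries.map (Int.castRingHom ℚ) zq) →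
          -- (S4) bounded denominators of rational cusp forms on `Γ₁(N)` (weights `k ≥ 1`)
          (∀ (k : ℤ), 1 ≤ k → ∀ (F : CuspForm (CongruenceSubgroup.Gamma1 N) k),
        (∀ n : ℕ, ∃ r : ℚ, PowerSeries.coeff n (UpperHalfPlane.qExpansion (1 : ℝ) F) = (r : ℂ)) →
        ∃ D : ℕ, D ≠ 0 ∧ ∀ n : ℕ, ∃ z : ℤ,
          PowerSeries.coeff n
            (UpperHalfPlane.qExpansion (1 : ℝ) (fun τ : UpperHalfPlane ↦ (D : ℂ) * F τ)) = (z : ℂ)) →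
          ∃ (k : ℤ) (h : CuspForm Γ' k) (M : ℕ),
            (h : UpperHalfPlane → ℂ) ≠ 0 ∧
            (∀ γ ∈ CongruenceSubgroup.Gamma1 N, γ ∉ Γ' → (h : UpperHalfPlane → ℂ) ∣[k] γ = -h) ∧
            M ≠ 0 ∧
            ∀ n : ℕ, ∃ z : ℤ,
              PowerSeries.coeff n
                (UpperHalfPlane.qExpansion (1 : ℝ) (fun τ : UpperHalfPlane ↦ (M : ℂ) * h τ)) = (z : ℂ) := by
  intro W₁ _ _ N _ f hW₁ L₁ hL₁ c₁ hc₁ hin x₁ _hx₁ lam hlam hlam2 hwp Γ' hΓ B hB0 hBsq zq hz0 hz1 hzsum Bint hBint hS4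
  obtain ⟨g, hg1, hg2, hg3⟩ :=
    Summit.BirchSwinnertonDyer.BirchSwinnertonDyer.Theorems.DepletionAtTwo.KummerFn.stub_kummerFn L₁ lam hlam hlam2
  obtain ⟨k, G₁, Φ₁, hk, hG0, hGrat, hΦ⟩ :=
    Summit.BirchSwinnertonDyer.BirchSwinnertonDyer.Theorems.DepletionAtTwo.X1Denominator.stub_x1Denominator W₁ f hW₁ L₁ hL₁ c₁ hc₁ hin
  obtain ⟨h, hh0, hanti, hsq⟩ :=
    Summit.BirchSwinnertonDyer.BirchSwinnertonDyer.Theorems.DepletionAtTwo.KummerForm.stub_kummerForm W₁ f hW₁ L₁ hL₁ c₁ hc₁ hin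
      x₁ lam hlam hlam2 hwp Γ' hΓ g hg1 hg2 hg3 k G₁ Φ₁ hG0 hΦ
  have hT1 : ModularGroup.T ∈ CongruenceSubgroup.Gamma1 N := by
    rw [CongruenceSubgroup.Gamma1_mem]
    simp [ModularGroup.T]
  have hTtr : ((ModularGroup.T : SL(2, ℤ)) : Matrix (Fin 2) (Fin 2) ℤ).trace = 2 := by
    simp [ModularGroup.T, Matrix.trace_fin_two]
  have hT : ModularGroup.T ∈ Γ' :=
    Summit.BirchSwinnertonDyer.BirchSwinnertonDyer.Theorems.DepletionAtTwo.ParityGroup.mem_of_trace_eq_two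
      f L₁ c₁ lam hΓ hT1 hTtr
  obtain ⟨hi, hii, hlinh, hlinΦ⟩ :=
    Summit.BirchSwinnertonDyer.BirchSwinnertonDyer.Theorems.DepletionAtTwo.KummerQExp.stub_kummerQExp W₁ f hW₁ L₁ hL₁ c₁ hc₁ x₁ B
      hB0 hBsq zq hz0 hz1 hzsum k G₁ Φ₁ hΦ Γ' hT h hsq
  obtain ⟨hΦrat, hint⟩ :=
    Summit.BirchSwinnertonDyer.BirchSwinnertonDyer.Theorems.DepletionAtTwo.KummerAlg.kummerAlg_of_substInt W₁ B hB0 zq hz0 hz1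
      Bint hBint _ _ _ hGrat hi hii
  obtain ⟨D, hD0, hDint⟩ := hS4 k hk Φ₁ hΦrat
  refine ⟨k, h, 2 * D, hh0, hanti, by positivity, fun n ↦ ?_⟩
  have hDint' : ∀ n : ℕ, ∃ z : ℤ, PowerSeries.coeff n (PowerSeries.C (D : ℂ) * UpperHalfPlane.qExpansion (1 : ℝ) Φ₁) = (z : ℂ) := by
    intro m
    rw [← hlinΦ (D : ℂ)]
    exact hDint m
  obtain ⟨z, hz⟩ := hint D hD0 hDint' n
  refine ⟨z, ?_⟩
  rw [hlinh, hz]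

/-- **Registered stub S2 `stub_evenKummerForm` of line `star` v18 — PROVED (signature verbatim).**  For `W₀` globally minimal with
newform `f` (level `N` odd, ordinary at `2`), Néron lattice `L₀ = q·Λ_f` with `q` EVEN, an ÉTALE rational 2-torsion abscissa `x₀` with
half-period `λ/2` and its parity group `Γ′`: `Γ′` carries a non-zero anti-invariant cusp form with an integral multiple.  Proof: `q = m + m`;
`Z_q = [2](Z_m)` (`formalMul_two_subst_formalExp_subst`), `Z_m ∈ ℤ⟦q⟧` (Honda), so `B(Z_q) = (B∘[2])(Z_m) ∈ ℤ⟦q⟧` by the even square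
law (`evenSquareLaw`); then `sqrtCuspForm_even` with bounded denominators on `Γ₁(N)`, `N ≥ 11`.  (The hypotheses `¬ 2 ∣ N`, `IsOrdinaryAt`,
`L₀ ⊆ qΛ_f`, `∃ γ₀ ∉ Γ′` of the registered signature are idle.) [cite: SilvermanAEC2009, IV.2, VI.3.6] [cite: ShimuraIATAF1971, Thm. 3.52] -/
theorem stub_evenKummerForm :
    ∀ (W₀ : WeierstrassCurve ℚ) [W₀.IsElliptic] [W₀.IsGloballyMinimal] ⦃N : ℕ⦄ [NeZero N]
      (f : CuspForm (CongruenceSubgroup.Gamma0 N) 2), IsNewformOf W₀ f → ¬ 2 ∣ N → IsOrdinaryAt W₀ 2 →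
      ∀ (L₀ : PeriodPair), IsNeronLatticeOf (W₀.baseChange ℂ) L₀ → ∀ (q : ℤ), q ≠ 0 → Even q →
      (∀ z ∈ periodLattice f, (q : ℂ) * z ∈ L₀.lattice) → (∀ z ∈ L₀.lattice, ∃ w ∈ periodLattice f, z = (q : ℂ) * w) →
      ∀ (x₀ : ℚ), HasRationalTwoTorsionX W₀ x₀ → ¬ TwoTorsionRamifiedAtTwo x₀ →
      ∀ (lam : ℂ), lam ∈ L₀.lattice → lam / 2 ∉ L₀.lattice →
        L₀.weierstrassP (lam / 2) - ((W₀.b₂ : ℚ) : ℂ) / 12 = ((x₀ : ℚ) : ℂ) →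
      ∀ Γ' : Subgroup SL(2, ℤ),
        (∀ γ : SL(2, ℤ), γ ∈ Γ' ↔ ∃ hγ : γ ∈ CongruenceSubgroup.Gamma0 N, γ ∈ CongruenceSubgroup.Gamma1 N ∧
          ∃ k : ℤ, ∃ w ∈ L₀.lattice, ((q : ℚ) : ℂ) * cuspSymbol f ⟨γ, hγ⟩ = (k : ℂ) * lam + 2 * w) →
        (∃ γ₀ ∈ CongruenceSubgroup.Gamma1 N, γ₀ ∉ Γ') →
        ∃ (k : ℤ) (h : CuspForm Γ' k) (M : ℕ),
          (h : UpperHalfPlane → ℂ) ≠ 0 ∧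
          (∀ γ ∈ CongruenceSubgroup.Gamma1 N, γ ∉ Γ' → (h : UpperHalfPlane → ℂ) ∣[k] γ = -h) ∧
          M ≠ 0 ∧
          ∀ n : ℕ, ∃ z : ℤ,
            PowerSeries.coeff n (UpperHalfPlane.qExpansion (1 : ℝ) (fun τ : UpperHalfPlane ↦ (M : ℂ) * h τ)) = (z : ℂ) := by
  intro W₀ _ _ N _ f hW₀ _hN _hord L₀ hL₀ q hq0 hqev hin _hout x₀ hx₀ hnr lam hlam hlam2 hwp Γ' hΓ _hγ₀
  have hZ := Summit.BirchSwinnertonDyer.BirchSwinnertonDyer.Theorems.DepletionAtTwo.ParamExpansion.stub_paramExpansion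
  -- the level of a newform of an elliptic curve is at least `11`
  have h11 : 11 ≤ N := by
    by_contra hlt
    have hf0 : f = 0 := cuspForm_two_gamma0_eq_zero_of_le_ten (by omega) f
    have h1 : cuspCoeff f 1 = (W₀.LFunction 1 : ℂ) := hW₀.2 1
    rw [hf0, WeierstrassCurve.LFunction_apply_one] at h1
    have h0 : cuspCoeff (0 : CuspForm (CongruenceSubgroup.Gamma0 N) 2) 1 = 0 :=
      (cuspCoeffₗ (one_mem_strictPeriods_coe_gamma0 N) 1).map_zero
    rw [h0] at h1
    norm_num at h1
  -- casts: the rational scale `c₁ = q`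
  have hq0' : (q : ℚ) ≠ 0 := by exact_mod_cast hq0
  have hcast : (((q : ℚ) : ℂ)) = (q : ℂ) := Rat.cast_intCast q
  have hin₁ : ∀ z ∈ periodLatticeGamma1 f, ((q : ℚ) : ℂ) * z ∈ L₀.lattice := fun z hz ↦ by
    rw [hcast]; exact hin z (periodLatticeGamma1_le_periodLattice f hz)
  -- (S1') the square root
  obtain ⟨B, hB0, hBsq⟩ := exists_formalSqrt W₀ x₀
  -- (S2) the integer series `Z_q = exp(q·ℓ)`, `Z_m = exp(m·ℓ)` (`q = m + m`) and the analytic meaning of `Z_q`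
  obtain ⟨hZ0, hZ1, A, hA⟩ := hZ W₀ f hW₀ L₀ hL₀ (q : ℚ) hq0'
  choose kq hkq using
    Summit.BirchSwinnertonDyer.BirchSwinnertonDyer.Theorems.DepletionAtTwo.ParamIntegral.stub_paramIntegralFormal W₀ q
  obtain ⟨m, hm⟩ := hqev
  choose km hkm using
    Summit.BirchSwinnertonDyer.BirchSwinnertonDyer.Theorems.DepletionAtTwo.ParamIntegral.stub_paramIntegralFormal W₀ m
  set ℓ : PowerSeries ℚ := PowerSeries.mk fun j : ℕ ↦ ((W₀.LFunction j : ℤ) : ℚ) / j with hℓ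
  set zq : PowerSeries ℤ := PowerSeries.mk kq with hzq
  have hzqmap : PowerSeries.map (Int.castRingHom ℚ) zq = W₀.formalExp.subst ((q : ℚ) • ℓ) := by
    ext n
    rw [coeff_map, hzq, coeff_mk, eq_intCast, hkq n]
  have hz0 : PowerSeries.constantCoeff zq = 0 := by
    have h := hkq 0
    rw [PowerSeries.coeff_zero_eq_constantCoeff, hZ0] at h
    rw [hzq, ← PowerSeries.coeff_zero_eq_constantCoeff_apply, PowerSeries.coeff_mk]
    exact_mod_cast h.symm
  have hz1 : PowerSeries.coeff 1 zq ≠ 0 := by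
    have h := hkq 1
    rw [hZ1] at h
    rw [hzq, PowerSeries.coeff_mk]
    intro h0
    rw [h0, Int.cast_zero] at h
    exact hq0' h
  have hzexp : ∃ A : ℝ, ∀ τ : UpperHalfPlane, A < τ.im →
      HasSum (fun n : ℕ ↦ ((PowerSeries.coeff n zq : ℤ) : ℂ) *
          Complex.exp (2 * Real.pi * Complex.I * (τ : ℂ)) ^ n)
        (-(L₀.weierstrassP (((q : ℚ) : ℂ) * eichlerIntegral f τ) - ((W₀.b₂ : ℚ) : ℂ) / 12) /
          ((L₀.derivWeierstrassP (((q : ℚ) : ℂ) * eichlerIntegral f τ)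
            - ((W₀.a₁ : ℚ) : ℂ) * (L₀.weierstrassP (((q : ℚ) : ℂ) * eichlerIntegral f τ) - ((W₀.b₂ : ℚ) : ℂ) / 12)
            - ((W₀.a₃ : ℚ) : ℂ)) / 2)) := by
    refine ⟨A, fun τ hτ ↦ ?_⟩
    have hfun : (fun n : ℕ ↦ ((PowerSeries.coeff n zq : ℤ) : ℂ) * Complex.exp (2 * Real.pi * Complex.I * (τ : ℂ)) ^ n) =
        fun n : ℕ ↦ ((PowerSeries.coeff n (W₀.formalExp.subst ((q : ℚ) • ℓ)) : ℚ) : ℂ) *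
            Complex.exp (2 * Real.pi * Complex.I * (τ : ℂ)) ^ n := by
      funext n
      rw [hkq n, hzq, PowerSeries.coeff_mk, Rat.cast_intCast]
    rw [hfun]
    exact hA τ hτ
  -- the half multiple: `Z_m ∈ ℤ⟦q⟧`, `Z_q = [2](Z_m)`
  set zm : PowerSeries ℤ := PowerSeries.mk km with hzm
  have hzmmap : PowerSeries.map (Int.castRingHom ℚ) zm = W₀.formalExp.subst ((m : ℚ) • ℓ) := by
    ext n
    rw [coeff_map, hzm, coeff_mk, eq_intCast, hkm n]
  have hℓ0 : PowerSeries.constantCoeff ℓ = 0 := by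
    rw [← coeff_zero_eq_constantCoeff_apply, hℓ, coeff_mk]; simp
  have hmℓ0 : PowerSeries.constantCoeff ((m : ℚ) • ℓ) = 0 := by
    rw [smul_eq_C_mul, map_mul, hℓ0, mul_zero]
  have hZm0 : PowerSeries.constantCoeff (W₀.formalExp.subst ((m : ℚ) • ℓ)) = 0 :=
    constantCoeff_subst_eq_zero hmℓ0 _ W₀.constantCoeff_formalExp
  have hsZm : HasSubst (W₀.formalExp.subst ((m : ℚ) • ℓ)) := HasSubst.of_constantCoeff_zero' hZm0
  have hzm0 : PowerSeries.constantCoeff zm = 0 := by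
    have h := hkm 0
    rw [PowerSeries.coeff_zero_eq_constantCoeff, hZm0] at h
    rw [hzm, ← PowerSeries.coeff_zero_eq_constantCoeff_apply, PowerSeries.coeff_mk]
    exact_mod_cast h.symm
  have hsm : HasSubst zm := HasSubst.of_constantCoeff_zero' hzm0
  have hqm : (q : ℚ) • ℓ = (m : ℚ) • ℓ + (m : ℚ) • ℓ := by
    rw [← add_smul, ← Int.cast_add, ← hm]
  have hdouble : PowerSeries.map (Int.castRingHom ℚ) zq =
      (W₀.formalMul 2).subst (PowerSeries.map (Int.castRingHom ℚ) zm) := by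
    rw [hzqmap, hzmmap, formalMul_two_subst_formalExp_subst W₀ hmℓ0, hqm]
  -- (SqL): `B∘[2] ∈ ℤ⟦T⟧`, hence `B(Z_q) = (B∘[2])(Z_m) ∈ ℤ⟦q⟧`
  obtain ⟨R, hR⟩ := evenSquareLaw W₀ hx₀ hnr B hB0 hBsq
  have hBint : PowerSeries.map (Int.castRingHom ℚ) (R.subst zm) = B.subst (PowerSeries.map (Int.castRingHom ℚ) zq) := by
    rw [WeierstrassCurve.powerSeries_map_subst _ hsm, hR, hdouble, hzmmap,
      subst_comp_subst_apply (W₀.hasSubst_formalMul 2) hsZm]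
  -- the engine
  exact sqrtCuspForm_even W₀ f hW₀ L₀ hL₀ (q : ℚ) hq0' hin₁ x₀ hx₀ lam hlam hlam2 hwp Γ' hΓ B hB0 hBsq zq hz0 hz1 hzexp
    (R.subst zm) hBint
    (Summit.BirchSwinnertonDyer.BirchSwinnertonDyer.Theorems.DepletionAtTwo.Gamma1Bounded.stub_gamma1Bounded N (by omega))

end Summit.BirchSwinnertonDyer.BirchSwinnertonDyer.Theorems.DepletionAtTwo.EvenBranch

end
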